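import Summits.QuantumFields.BalabanUV.Beta.EriceRemainderEnclosureHistoryAutonomyComparisonNonlinearModulus

/-!
# EriceRemainderEnclosureHistoryAutonomyComparisonNonlinearLightPrep — (E120a) THE DEFECT NEEDS NO MODULUS WHEN THE BASE IS LIGHT BELOW.  Base `B u = β₀ + Σ_{k<K} L_k·u_k`
# (`β₀ > 0`, `L ≥ 0`, `L_0 = 0`); `B′ ≥ B` with ISOTONE excess `E` of ANY size and ANY steepness (a modulus of `B′` is kept only for its solution family).  Within a
# configuration `c` (pin `h_c`, solution `h″ = S′(h_c)`), EXACTLY `δ_{k+1} − δ_k = ẽ_{k+1} − D_{k+1}` with `ẽ_j = E(h″(j+·)) ≥ 0` NON-INCREASING in the depth and `D_{k+1}`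
# the configuration's affine drop at depth `k+1`, `D_{k+1} ≤ Σ_{k′} c_{m,k′}·δ_{k+1+k′}` (`m = c+1+k`); the deeper gaps exceed `δ_{k+1}` by at most the excess accumulated in
# between, `δ_{k+1+k′} ≤ δ_{k+1} + k′·ẽ_{k+1}`; so `D_{k+1} ≤ F(m)δ_{k+1} + T(m)ẽ_{k+1}` and **`δ_k − δ_{k+1} ≤ F(m)·δ_k` whenever the row `m` is LIGHT, `T(m) =
# Σ_{k′} k′·L_{k′}h_{m+k′}³∕2 ≤ 1`** (**`conf_incr_ge_light`**) — the constant-excess defect of (E118a) `conf_incr_ge`, with no modulus, no pin sensitivity and no sign of the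
# deeper step quantities.  Hence (**`row_ge_light`**) the nonlinear row inequality of (E118b) with excess-modulus term `0`, for EVERY isotone excess, at every row `n` whose
# deeper rows `m ≥ n+2` are light — (E118b)'s proof re-run with `conf_incr_ge_light`.  The sequels (E120b∕c) run the gauge induction: comparison at any size for every
# isotone excess along every orbit that is light below its second row (all the cell's numerics have `T ≤ 0.85`).

Cell `pub-balaban`, β-function sub-cell, BINDER row D4 «RemainderConst leaves for Bałaban's split» (`HOME/BINDER-OWNERS.md`; owner lineage `b2b-balaban-beta-an4`;
this file by co-owner #2 lineage `b2b-balaban-beta-d4-p2`, generation 98), β-FLOW TEAM duty (1), FREEZE (0) honoured (def-free; imports (E119d); uses (E118a) `affine_facts` ∕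
`inv_sqrt_facts` ∕ `heating_le` ∕ `step_eq_drop` ∕ `sum_range_eq_Ico_of_zero` ∕ `conf_sandwich` ∕ `conf_first_le_step`, (E119b) `excess_facts`, (E48a) `family_mem` ∕
`family_tail_eq` ∕ `family_zero` ∕ `strictAnti_of_memFlow`, node U2's `Sharpness.abs_sub_le_half_cube_mul` BY NAME; `row_ge_light` is (E118b)'s proof re-run).

HONEST FRAMING (page 1, verbatim and binding).  *"Discharging BetaPertH makes Bałaban's UV stability UNCONDITIONAL — a real constructive-QFT result; it is
NOT the continuum limit and NOT the Clay problem."*  THIS FILE DISCHARGES NOTHING OF THE KIND.  Elementary real analysis about ABSTRACT functionals on a box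
]0,γ]^ℕ with displayed floors, moduli, profiles and signs — hypotheses of a census, not facts; the form, signs, ages and moments of Bałaban's (1.22) limit
functional are NOT PRINTED ([I] p. 298; GAPS G-t4-U2-1∕-2) and NOT asserted.  Row D4 class UNCHANGED (critical-path width 0; instance 0∕1; D4 DISCHARGE NO
DATE).  HONEST DEPENDENCY: continuum YM on T⁴ ⇐ BetaPertH ∧ nine spine estimates (0/9 proved); BetaPertH ⇐ (D1) ∧ (D4) ∧ CAP+tail; G-an2-4 gates asym, D1
and NE2/3/4.  NOT CLAIMED here: the comparison theorem (sequel); anything printed — NOT B12 Thm 2, NOT BetaPertH, NOT continuum, NOT Clay.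

WHAT IS PROVED ([folklore]; 0 `def`, 0 sorry).  **`conf_incr_ge_light`**, **`row_ge_light`**.
-/

noncomputable section
open Finset Set

namespace Summit.QuantumFields.BalabanUV.Beta.EriceRemainderEnclosureHistoryAutonomyComparisonNonlinearLightPrep

open Literature.MathematicalPhysics.QuantumFieldTheory.Balaban1983to89
open Literature.MathematicalPhysics.QuantumFieldTheory.Balaban1983to89.T4BetaStationary
open Literature.MathematicalPhysics.QuantumFieldTheory.Balaban1983to89.T4BetaFlowWellPosed
open Literature.MathematicalPhysics.QuantumFieldTheory.Balaban1983to89.T4BetaFlowWellPosed.Sharpness (abs_sub_le_half_cube_mul)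
open Summit.QuantumFields.BalabanUV.Beta.EriceRemainderEnclosureHistoryAutonomyOrder (family_mem family_tail_eq family_zero strictAnti_of_memFlow)
open Summit.QuantumFields.BalabanUV.Beta.EriceRemainderEnclosureHistoryAutonomyComparisonNonlinearRowPrep
  (affine_facts inv_sqrt_facts heating_le step_eq_drop sum_range_eq_Ico_of_zero conf_sandwich conf_first_le_step)
open Summit.QuantumFields.BalabanUV.Beta.EriceRemainderEnclosureHistoryAutonomyComparisonNonlinearModulusPrep (excess_facts)

variable {B B' : (ℕ → ℝ) → ℝ} {γ β₀ b' M' : ℝ} {L : ℕ → ℝ} {K : ℕ} {S S' : ℝ → ℕ → ℝ}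

/-- **THE DAMPING DEFECT WITHOUT A MODULUS, BELOW A LIGHT ROW.**  Base affine (`L_0 = 0`), `B′ ≥ B` with isotone excess; configuration `c` comparing (`S′(h_c)_j ≤ h_{c+j}`);
depth `k`, `m = c+1+k` with `T(m) = Σ_{1≤q<K} q·L_qh_{m+q}³∕2 ≤ 1`.  Then with `δ_j = 1∕S′(h_c)_j² − 1∕h_{c+j}²`:
`δ_k − δ_{k+1} ≤ (Σ_{1≤q<K} L_qh_{m+q}³∕2)·δ_k`. [folklore] -/
theorem conf_incr_ge_light (hBaff : ∀ u, SeqBox γ u → B u = β₀ + ∑ k ∈ range K, L k * u k) (hL : ∀ k, 0 ≤ L k) (hL0 : L 0 = 0) (hβ : 0 < β₀)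
    (hexc : ∀ u, SeqBox γ u → B u ≤ B' u)
    (hDmono : ∀ u v : ℕ → ℝ, SeqBox γ u → SeqBox γ v → (∀ j, u j ≤ v j) → B' u - B u ≤ B' v - B v)
    (hS : ∀ p, 0 < p → p ≤ γ → SeqBox γ (S p) ∧ MemFlow B p (S p))
    (hS' : ∀ p, 0 < p → p ≤ γ → SeqBox γ (S' p) ∧ MemFlow B' p (S' p))
    {y : ℝ} (hy : 0 < y) (hyγ : y ≤ γ) (c k : ℕ) (hcmpc : ∀ j, S' (S y c) j ≤ S y (c + j))
    (hT : ∑ q ∈ Ico 1 K, (q : ℝ) * (L q * S y (c + 1 + k + q) ^ 3 / 2) ≤ 1) :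
    (1 / S' (S y c) k ^ 2 - 1 / S y (c + k) ^ 2) - (1 / S' (S y c) (k + 1) ^ 2 - 1 / S y (c + k + 1) ^ 2)
      ≤ (∑ q ∈ Ico 1 K, L q * S y (c + 1 + k + q) ^ 3 / 2) * (1 / S' (S y c) k ^ 2 - 1 / S y (c + k) ^ 2) := by
  obtain ⟨hmono', hlo'⟩ := excess_facts hBaff hL hβ hexc hDmono
  have hqc := family_mem hS hy hyγ c
  have hw := hS' _ hqc.1 hqc.2
  have hf := (hS y hy hyγ).2
  have hh := (hS y hy hyγ).1
  have hpos : ∀ j, 0 < S y j := fun j => (hh j).1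
  have hwpos : ∀ j, 0 < S' (S y c) j := fun j => (hw.1 j).1
  have hwanti := (strictAnti_of_memFlow hβ hlo' hw.1 hw.2).antitone
  -- notation: δ j, ẽ j, the increments
  set δ : ℕ → ℝ := fun j => 1 / S' (S y c) j ^ 2 - 1 / S y (c + j) ^ 2 with hδ
  set ex : ℕ → ℝ := fun j => B' (fun i => S' (S y c) (j + i)) - B (fun i => S' (S y c) (j + i)) with hex
  have hδ0 : ∀ j, 0 ≤ δ j := fun j => by
    simp only [hδ]; exact sub_nonneg.mpr (one_div_le_one_div_of_le (pow_pos (hwpos j) 2) (pow_le_pow_left₀ (hwpos j).le (hcmpc j) 2))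
  have hex0 : ∀ j, 0 ≤ ex j := fun j => by simp only [hex]; linarith [hexc _ (seqBox_shift hw.1 j)]
  have hexanti : ∀ j j', j ≤ j' → ex j' ≤ ex j := fun j j' hjj' =>
    hDmono _ _ (seqBox_shift hw.1 j') (seqBox_shift hw.1 j) fun i => hwanti (by omega)
  -- the increment identity: δ (j+1) − δ j = ẽ (j+1) − D (j+1), D = the affine drop of the configuration at depth j+1
  have hinc : ∀ j, δ (j + 1) - δ j = ex (j + 1) - ∑ q ∈ range K, L q * (S y (c + (j + 1) + q) - S' (S y c) (j + 1 + q)) := by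
    intro j
    have e1 : 1 / S' (S y c) (j + 1) ^ 2 = 1 / S' (S y c) j ^ 2 + B' (fun i => S' (S y c) (j + 1 + i)) := hw.2.2 j
    have e2 : 1 / S y (c + (j + 1)) ^ 2 = 1 / S y (c + j) ^ 2 + B (fun i => S y (c + j + 1 + i)) := by
      rw [show c + (j + 1) = c + j + 1 by ring]; exact hf.2 (c + j)
    have hB1 := hBaff _ (seqBox_shift hw.1 (j + 1))
    have hB2 := hBaff _ (seqBox_shift hh (c + j + 1))
    simp only [hδ, hex]
    rw [e1, e2, hB1, hB2]
    have : ∑ q ∈ range K, L q * (S y (c + (j + 1) + q) - S' (S y c) (j + 1 + q))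
        = ∑ q ∈ range K, L q * S y (c + j + 1 + q) - ∑ q ∈ range K, L q * S' (S y c) (j + 1 + q) := by
      rw [← sum_sub_distrib]; exact sum_congr rfl fun q _ => by rw [show c + (j + 1) + q = c + j + 1 + q by ring]; ring
    rw [this]; ring
  -- increments are at most the excess: δ (j+1) ≤ δ j + ẽ (j+1)
  have hD0 : ∀ j, 0 ≤ ∑ q ∈ range K, L q * (S y (c + (j + 1) + q) - S' (S y c) (j + 1 + q)) := fun j =>
    sum_nonneg fun q _ => mul_nonneg (hL q) (by have := hcmpc (j + 1 + q); rw [show c + (j + 1 + q) = c + (j + 1) + q by ring] at this; linarith)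
  have hstep : ∀ j, δ (j + 1) ≤ δ j + ex (j + 1) := fun j => by have := hinc j; have := hD0 j; linarith
  -- deeper gaps: δ (k+1+q) ≤ δ (k+1) + q · ẽ (k+1)
  have hdeep : ∀ q, δ (k + 1 + q) ≤ δ (k + 1) + (q : ℝ) * ex (k + 1) := by
    intro q
    induction q with
    | zero => simp
    | succ q ih =>
      have h1 := hstep (k + 1 + q)
      have h2 := hexanti (k + 1) (k + 1 + q + 1) (by omega)
      rw [show k + 1 + (q + 1) = k + 1 + q + 1 by ring]
      push_cast; linarith
  -- the drop at depth k+1: D ≤ Σ_q c_{m,q} δ (k+1+q) ≤ F δ(k+1) + T ẽ(k+1)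
  have hDle : ∑ q ∈ range K, L q * (S y (c + (k + 1) + q) - S' (S y c) (k + 1 + q))
      ≤ (∑ q ∈ Ico 1 K, L q * S y (c + 1 + k + q) ^ 3 / 2) * δ (k + 1)
        + (∑ q ∈ Ico 1 K, (q : ℝ) * (L q * S y (c + 1 + k + q) ^ 3 / 2)) * ex (k + 1) := by
    rw [sum_range_eq_Ico_of_zero (f := fun q => L q * (S y (c + (k + 1) + q) - S' (S y c) (k + 1 + q))) (by simp [hL0]), sum_mul, sum_mul, ← sum_add_distrib]
    refine sum_le_sum fun q _ => ?_
    have hc := hcmpc (k + 1 + q)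
    rw [show c + (k + 1 + q) = c + (k + 1) + q by ring] at hc
    have h1 := hpos (c + (k + 1) + q); have h2 := hwpos (k + 1 + q)
    have habs := abs_sub_le_half_cube_mul h1 h2 le_rfl hc
    have hg0 : 0 ≤ S y (c + (k + 1) + q) - S' (S y c) (k + 1 + q) := by linarith
    have hd0 : 0 ≤ 1 / S' (S y c) (k + 1 + q) ^ 2 - 1 / S y (c + (k + 1) + q) ^ 2 :=
      sub_nonneg.mpr (one_div_le_one_div_of_le (pow_pos h2 2) (pow_le_pow_left₀ h2.le hc 2))
    rw [abs_of_nonneg hg0, abs_sub_comm, abs_of_nonneg hd0] at habs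
    have hgap : 1 / S' (S y c) (k + 1 + q) ^ 2 - 1 / S y (c + (k + 1) + q) ^ 2 = δ (k + 1 + q) := by
      simp only [hδ]; rw [show c + (k + 1 + q) = c + (k + 1) + q by ring]
    rw [hgap] at habs
    have := habs.trans (mul_le_mul_of_nonneg_left (hdeep q) (by positivity))
    rw [show c + (k + 1) + q = c + 1 + k + q by ring] at this ⊢
    have hLq := hL q
    calc L q * (S y (c + 1 + k + q) - S' (S y c) (k + 1 + q))
        ≤ L q * (S y (c + 1 + k + q) ^ 3 / 2 * (δ (k + 1) + (q : ℝ) * ex (k + 1))) := mul_le_mul_of_nonneg_left this hLq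
      _ = L q * S y (c + 1 + k + q) ^ 3 / 2 * δ (k + 1) + (q : ℝ) * (L q * S y (c + 1 + k + q) ^ 3 / 2) * ex (k + 1) := by ring
  -- conclude: ε(1+F) ≥ ẽ(1 − T) − F δ k ≥ −F δ k
  set F : ℝ := ∑ q ∈ Ico 1 K, L q * S y (c + 1 + k + q) ^ 3 / 2 with hF
  have hF0 : 0 ≤ F := sum_nonneg fun q _ => by have := hL q; have := hpos (c + 1 + k + q); positivity
  have hεeq := hinc k
  have hT0 : 0 ≤ ∑ q ∈ Ico 1 K, (q : ℝ) * (L q * S y (c + 1 + k + q) ^ 3 / 2) :=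
    sum_nonneg fun q _ => by have := hL q; have := hpos (c + 1 + k + q); positivity
  have h1 : δ (k + 1) - δ k ≥ ex (k + 1) - F * δ (k + 1) - (∑ q ∈ Ico 1 K, (q : ℝ) * (L q * S y (c + 1 + k + q) ^ 3 / 2)) * ex (k + 1) := by
    linarith [hDle]
  have h2 : (∑ q ∈ Ico 1 K, (q : ℝ) * (L q * S y (c + 1 + k + q) ^ 3 / 2)) * ex (k + 1) ≤ ex (k + 1) := by
    have := mul_le_mul_of_nonneg_right hT (hex0 (k + 1)); linarith
  have h3 : (δ (k + 1) - δ k) * (1 + F) ≥ -(F * δ k) := by nlinarith [hδ0 k, hδ0 (k + 1), hex0 (k + 1)]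
  have goal : δ k - δ (k + 1) ≤ F * δ k := by
    by_cases hε : 0 ≤ δ (k + 1) - δ k
    · nlinarith [hδ0 k]
    · have hε' := lt_of_not_ge hε; nlinarith [hδ0 k]
  have eidx : 1 / S' (S y c) (k + 1) ^ 2 - 1 / S y (c + k + 1) ^ 2 = δ (k + 1) := by simp only [hδ]; rw [show c + k + 1 = c + (k + 1) by ring]
  rw [eidx]
  exact goal

set_option maxHeartbeats 800000 in
/-- **THE NONLINEAR ROW INEQUALITY FOR EVERY ISOTONE EXCESS, BELOW LIGHT ROWS.**  Base affine (`L_0 = 0`); `B′ ≥ B` isotone with floor, modulus, ISOTONE excess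
(no modulus condition on the excess); base orbit `h = S y`.  If the configurations compare from every pin `h_m`, `m ≥ n`, and the rows `m ≥ n+2` are light
(`T(m) ≤ 1`), then the row inequality of (E118b) `row_ge` holds with excess-modulus term `0` — (E118b)'s proof with `conf_incr_ge_light`. [folklore] -/
theorem row_ge_light (hBaff : ∀ u, SeqBox γ u → B u = β₀ + ∑ k ∈ range K, L k * u k) (hL : ∀ k, 0 ≤ L k) (hL0 : L 0 = 0) (hβ : 0 < β₀)
    (hmono' : ∀ u v : ℕ → ℝ, SeqBox γ u → SeqBox γ v → (∀ j, u j ≤ v j) → B' u ≤ B' v) (hb' : 0 < b')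
    (hB' : ∀ u u' : ℕ → ℝ, SeqBox γ u → SeqBox γ u' → ∀ D : ℝ, (∀ j, |u j - u' j| ≤ D) → |B' u - B' u'| ≤ M' * D) (hM' : 0 ≤ M')
    (hlo' : ∀ u, SeqBox γ u → b' ≤ B' u) (hexc : ∀ u, SeqBox γ u → B u ≤ B' u)
    (hDmono : ∀ u v : ℕ → ℝ, SeqBox γ u → SeqBox γ v → (∀ j, u j ≤ v j) → B' u - B u ≤ B' v - B v)
    (hS : ∀ p, 0 < p → p ≤ γ → SeqBox γ (S p) ∧ MemFlow B p (S p))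
    (huniq : ∀ p, 0 < p → p ≤ γ → ∀ u u' : ℕ → ℝ, SeqBox γ u → SeqBox γ u' → MemFlow B p u → MemFlow B p u' → u = u')
    (hS' : ∀ p, 0 < p → p ≤ γ → SeqBox γ (S' p) ∧ MemFlow B' p (S' p))
    (huniq' : ∀ p, 0 < p → p ≤ γ → ∀ u u' : ℕ → ℝ, SeqBox γ u → SeqBox γ u' → MemFlow B' p u → MemFlow B' p u' → u = u')
    {y : ℝ} (hy : 0 < y) (hyγ : y ≤ γ) (n : ℕ)
    (hcmp : ∀ m, n ≤ m → ∀ j, S' (S y m) j ≤ S y (m + j))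
    (hT : ∀ m, n + 2 ≤ m → ∑ k ∈ Ico 1 K, (k : ℝ) * (L k * S y (m + k) ^ 3 / 2) ≤ 1) :
    ((B' (S' (S y n)) - B (S' (S y n))) - (B' (S' (S y (n + 1))) - B (S' (S y (n + 1)))))
      + (1 - ∑ k ∈ Ico 1 K, L k * S y (n + k) ^ 3 / 2) * (B' (S' (S y (n + 1))) - B (S (S y (n + 1))))
      - ∑ k ∈ Ico 1 K, (L k * S y (n + k) ^ 3 / 2 - L k * S y (n + 1 + k) ^ 3 / 2
            + L k * S y (n + 1 + k) ^ 3 / 2 * (∑ q ∈ Ico 1 K, L q * S y (n + k + 1 + q) ^ 3 / 2 + 0 * S y (n + k + 1) ^ 3 / 2))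
          * (1 / S' (S y (n + 1)) (k - 1) ^ 2 - 1 / S y (n + k) ^ 2)
      ≤ B' (S' (S y n)) - B (S (S y n)) := by
  obtain ⟨_, hloB, _, _⟩ := affine_facts hBaff hL hβ
  have hh := (hS y hy hyγ).1
  have hf := (hS y hy hyγ).2
  have hpos : ∀ j, 0 < S y j := fun j => (hh j).1
  have hanti := (strictAnti_of_memFlow hβ hloB hh hf).antitone
  have hqn := family_mem hS hy hyγ n
  have hq1 := family_mem hS hy hyγ (n + 1)
  have hw := hS' _ hqn.1 hqn.2          -- configuration n
  have hk := hS' _ hq1.1 hq1.2          -- configuration n+1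
  have hwpos : ∀ j, 0 < S' (S y n) j := fun j => (hw.1 j).1
  have hkpos : ∀ j, 0 < S' (S y (n + 1)) j := fun j => (hk.1 j).1
  have hwle : ∀ j, S' (S y n) j ≤ S y (n + j) := hcmp n le_rfl
  have hkle : ∀ j, S' (S y (n + 1)) j ≤ S y (n + 1 + j) := hcmp (n + 1) (by omega)
  -- the two step quantities as excess minus drop, drops summed over the ages 1 ≤ k < K
  have hXn := step_eq_drop hBaff hS huniq hS' hy hyγ n
  have hXn1 := step_eq_drop hBaff hS huniq hS' hy hyγ (n + 1)
  rw [sum_range_eq_Ico_of_zero (f := fun k => L k * (S y (n + k) - S' (S y n) k)) (by simp [family_zero hS' hqn.1 hqn.2])] at hXn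
  rw [sum_range_eq_Ico_of_zero (f := fun k => L k * (S y (n + 1 + k) - S' (S y (n + 1)) k)) (by simp [family_zero hS' hq1.1 hq1.2])] at hXn1
  -- the first increment of configuration n
  obtain ⟨hd0, hdX⟩ := conf_first_le_step hmono' hb' hB' hM' hlo' hS huniq hS' huniq' hy hyγ n (by have := hwle 1; exact this)
  have hX1 : 0 ≤ B' (S' (S y (n + 1))) - B (S (S y (n + 1))) := hd0.trans hdX
  set δn1 : ℝ := 1 / S' (S y n) 1 ^ 2 - 1 / S y (n + 1) ^ 2 with hδn1
  -- (c) per age: the drop of configuration n through the sandwich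
  have hc : ∀ k ∈ Finset.Ico 1 K, L k * (S y (n + k) - S' (S y n) k)
      ≤ L k * (S y (n + k) - S' (S y (n + 1)) (k - 1)) + L k * S y (n + k) ^ 3 / 2 * δn1 := by
    intro k hkK
    obtain ⟨j, rfl⟩ : ∃ j, k = j + 1 := ⟨k - 1, by have := (Finset.mem_Ico.mp hkK).1; omega⟩
    simp only [Nat.add_sub_cancel]
    have hsand := conf_sandwich hmono' hb' hB' hM' hlo' hS hS' huniq' hy hyγ n (hwle 1) j
    have hxM : S' (S y (n + 1)) j ≤ S y (n + (j + 1)) := by have := hkle j; rwa [show n + 1 + j = n + (j + 1) by ring] at this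
    have hwM : S' (S y n) (j + 1) ≤ S y (n + (j + 1)) := hwle (j + 1)
    have habs := abs_sub_le_half_cube_mul (hkpos j) (hwpos (j + 1)) hxM hwM
    have hsplit : S y (n + (j + 1)) - S' (S y n) (j + 1)
        ≤ (S y (n + (j + 1)) - S' (S y (n + 1)) j) + S y (n + (j + 1)) ^ 3 / 2 * δn1 := by
      by_cases hcase : S' (S y n) (j + 1) ≤ S' (S y (n + 1)) j
      · have hg0 : 0 ≤ S' (S y (n + 1)) j - S' (S y n) (j + 1) := by linarith
        have hl0 : 0 ≤ 1 / S' (S y n) (j + 1) ^ 2 - 1 / S' (S y (n + 1)) j ^ 2 :=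
          sub_nonneg.mpr (one_div_le_one_div_of_le (pow_pos (hwpos _) 2) (pow_le_pow_left₀ (hwpos _).le hcase 2))
        rw [abs_of_nonneg hg0, abs_sub_comm, abs_of_nonneg hl0] at habs
        have := habs.trans (mul_le_mul_of_nonneg_left hsand (by have := hpos (n + (j + 1)); positivity))
        linarith
      · have hcase := lt_of_not_ge hcase
        have : 0 ≤ S y (n + (j + 1)) ^ 3 / 2 * δn1 := by have := hpos (n + (j + 1)); positivity
        linarith
    have := mul_le_mul_of_nonneg_left hsplit (hL (j + 1))
    linarith
  -- (d) per age: the drop of configuration n+1 one row deeper, against the shifted drop: heating + damping defect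
  have hd : ∀ k ∈ Finset.Ico 1 K, -((L k * S y (n + k) ^ 3 / 2 - L k * S y (n + 1 + k) ^ 3 / 2
        + L k * S y (n + 1 + k) ^ 3 / 2 * (∑ q ∈ Ico 1 K, L q * S y (n + k + 1 + q) ^ 3 / 2 + 0 * S y (n + k + 1) ^ 3 / 2))
          * (1 / S' (S y (n + 1)) (k - 1) ^ 2 - 1 / S y (n + k) ^ 2))
      ≤ L k * (S y (n + 1 + k) - S' (S y (n + 1)) k) - L k * (S y (n + k) - S' (S y (n + 1)) (k - 1)) := by
    intro k hkK
    obtain ⟨j, rfl⟩ : ∃ j, k = j + 1 := ⟨k - 1, by have := (Finset.mem_Ico.mp hkK).1; omega⟩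
    simp only [Nat.add_sub_cancel]
    rw [show n + 1 + (j + 1) = n + (j + 1) + 1 by ring]
    set δ : ℝ := 1 / S' (S y (n + 1)) j ^ 2 - 1 / S y (n + (j + 1)) ^ 2 with hδ
    set δ' : ℝ := 1 / S' (S y (n + 1)) (j + 1) ^ 2 - 1 / S y (n + (j + 1) + 1) ^ 2 with hδ'
    set θ : ℝ := ∑ q ∈ Ico 1 K, L q * S y (n + (j + 1) + 1 + q) ^ 3 / 2 + 0 * S y (n + (j + 1) + 1) ^ 3 / 2 with hθdef
    have hx' := hpos (n + (j + 1) + 1)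
    have hxx' : S y (n + (j + 1) + 1) ≤ S y (n + (j + 1)) := hanti (by omega)
    have hkj : S' (S y (n + 1)) j ≤ S y (n + (j + 1)) := by have := hkle j; rwa [show n + 1 + j = n + (j + 1) by ring] at this
    have hkj1 : S' (S y (n + 1)) (j + 1) ≤ S y (n + (j + 1) + 1) := by
      have := hkle (j + 1); rwa [show n + 1 + (j + 1) = n + (j + 1) + 1 by ring] at this
    have hδ0 : 0 ≤ δ := sub_nonneg.mpr (one_div_le_one_div_of_le (pow_pos (hkpos j) 2) (pow_le_pow_left₀ (hkpos j).le hkj 2))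
    -- the lowered point z below h_{n+1+k} at level gap δ
    obtain ⟨hz0, hzle, hzlev⟩ := inv_sqrt_facts hx' hδ0
    set z : ℝ := 1 / Real.sqrt (1 / S y (n + (j + 1) + 1) ^ 2 + δ) with hz
    -- heating
    have hheat := heating_le (y := S' (S y (n + 1)) j) (y' := z) hx' hxx' hδ0 (hkpos j) hz0 (by rw [hδ]; ring) hzlev
    -- damping defect: δ − δ′ ≤ θ δ
    have hθ := conf_incr_ge_light hBaff hL hL0 hβ hexc hDmono hS hS' hy hyγ (n + 1) j hkle (hT (n + 1 + 1 + j) (by omega))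
    rw [show n + 1 + 1 + j = n + (j + 1) + 1 by ring, show n + 1 + j = n + (j + 1) by ring] at hθ
    have hθ' : δ - δ' ≤ θ * δ := by rw [hδ, hδ', hθdef, zero_mul, zero_div, add_zero]; exact hθ
    have hθ0 : 0 ≤ θ := by
      have : ∀ q, 0 ≤ L q * S y (n + (j + 1) + 1 + q) ^ 3 / 2 := fun q => by have := hL q; have := hpos (n + (j + 1) + 1 + q); positivity
      rw [hθdef, zero_mul, zero_div, add_zero]; exact sum_nonneg fun q _ => this q
    -- second part: z − S′(h_{n+1})_{j+1} ≥ −(cube/2)·θ·δ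
    have hsecond : -(S y (n + (j + 1) + 1) ^ 3 / 2 * (θ * δ)) ≤ z - S' (S y (n + 1)) (j + 1) := by
      by_cases hcase : S' (S y (n + 1)) (j + 1) ≤ z
      · have : 0 ≤ S y (n + (j + 1) + 1) ^ 3 / 2 * (θ * δ) := by have := mul_nonneg hθ0 hδ0; positivity
        linarith
      · have hcase := lt_of_not_ge hcase
        have habs := abs_sub_le_half_cube_mul (hkpos (j + 1)) hz0 hkj1 hzle
        have hg0 : 0 ≤ S' (S y (n + 1)) (j + 1) - z := by linarith
        have hl : 1 / z ^ 2 - 1 / S' (S y (n + 1)) (j + 1) ^ 2 = δ - δ' := by rw [hzlev, hδ']; ring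
        have hl0 : 0 ≤ 1 / z ^ 2 - 1 / S' (S y (n + 1)) (j + 1) ^ 2 :=
          sub_nonneg.mpr (one_div_le_one_div_of_le (pow_pos hz0 2) (pow_le_pow_left₀ hz0.le hcase.le 2))
        rw [abs_of_nonneg hg0, abs_sub_comm, abs_of_nonneg hl0, hl] at habs
        have := habs.trans (mul_le_mul_of_nonneg_left hθ' (by positivity))
        linarith
    -- assemble the age
    have htot : -((S y (n + (j + 1)) ^ 3 / 2 - S y (n + (j + 1) + 1) ^ 3 / 2 + S y (n + (j + 1) + 1) ^ 3 / 2 * θ) * δ)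
        ≤ (S y (n + (j + 1) + 1) - S' (S y (n + 1)) (j + 1)) - (S y (n + (j + 1)) - S' (S y (n + 1)) j) := by
      nlinarith [hheat, hsecond]
    have := mul_le_mul_of_nonneg_left htot (hL (j + 1))
    have e1 : L (j + 1) * -((S y (n + (j + 1)) ^ 3 / 2 - S y (n + (j + 1) + 1) ^ 3 / 2 + S y (n + (j + 1) + 1) ^ 3 / 2 * θ) * δ)
        = -((L (j + 1) * S y (n + (j + 1)) ^ 3 / 2 - L (j + 1) * S y (n + (j + 1) + 1) ^ 3 / 2
          + L (j + 1) * S y (n + (j + 1) + 1) ^ 3 / 2 * θ) * δ) := by ring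
    rw [e1] at this
    linarith
  -- sum the ages
  have hcsum := sum_le_sum hc
  have hdsum := sum_le_sum hd
  rw [sum_add_distrib] at hcsum
  rw [sum_neg_distrib, sum_sub_distrib] at hdsum
  have hF : ∑ k ∈ Ico 1 K, L k * S y (n + k) ^ 3 / 2 * δn1 = (∑ k ∈ Ico 1 K, L k * S y (n + k) ^ 3 / 2) * δn1 := by rw [sum_mul]
  rw [hF] at hcsum
  have hF0 : 0 ≤ ∑ k ∈ Ico 1 K, L k * S y (n + k) ^ 3 / 2 := sum_nonneg fun k _ => by have := hL k; have := hpos (n + k); positivity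
  have hFd : (∑ k ∈ Ico 1 K, L k * S y (n + k) ^ 3 / 2) * δn1 ≤ (∑ k ∈ Ico 1 K, L k * S y (n + k) ^ 3 / 2) * (B' (S' (S y (n + 1))) - B (S (S y (n + 1)))) :=
    mul_le_mul_of_nonneg_left hdX hF0
  nlinarith [hcsum, hdsum, hFd, hXn, hXn1]


end Summit.QuantumFields.BalabanUV.Beta.EriceRemainderEnclosureHistoryAutonomyComparisonNonlinearLightPrep

end
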